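import Literature.Probability.RandomPlanarGeometry.HexSAWPolygonCellsRun
import HarnessLib

/-!
# Cell calculus for honeycomb polygon surgery, XV: the map `E` on non-spike tops as a FUNCTION of the cell set

Topic `Literature/Probability/RandomPlanarGeometry` (lane «pcv-sawmu», a-p4 g21; sequel of `HexSAWPolygonCellsRun.lean`).

`E` of the step-two injection «OMEGA» (`HOME/pub-sawmu-a-p4/g21/omega/THEOREM-OMEGA-g21.md` §2): with `t` the top hexagon, `E S = flipImage`
if `L t ∈ S` (class X), `= roofImage` if `L t ∉ S` and `LR t ∈ S` (class Y⋆ / type R).  This file makes `t` and `E` functions of the cell set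
(`topCell S` by choice from `exists_isLexmax`; `eImage S`), records the type trichotomy at the top (`L t ∈ S`, or `LR t ∈ S`, or `t` is an
up-right spike with `nbrs t ∩ S ⊆ {LL t}` — `top_trichotomy`), and proves `perim (eImage S) = perim S + 2` on every nonempty set whose top is
not an up-right spike (`perim_eImage`).

Sources: N. Madras, G. Slade, *The Self-Avoiding Walk* (1993), §3.2, proof of Theorem 3.2.3 [MadrasSlade1993]; I. Jensen, J. Phys.: Conf.
Ser. 42 (2006) 163 [Jensen2006HoneycombPolygons].  Label (lane): LANE INFRASTRUCTURE; nothing new in writing.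
-/

open Finset

namespace Literature.Probability.RandomPlanarGeometry.SAW

namespace HexCell

/-- **The top hexagon as a function** (any value on the empty set). [cite: MadrasSlade1993, §3.2 (proof of Theorem 3.2.3)] -/
noncomputable def topCell (S : Finset Cell) : Cell :=
  if h : S.Nonempty then Classical.choose (exists_isLexmax h) else (0, 0)

/-- `topCell S` is the top hexagon of a nonempty `S`. [cite: MadrasSlade1993, §3.2 (proof of Theorem 3.2.3)] -/
theorem isLexmax_topCell {S : Finset Cell} (h : S.Nonempty) : IsLexmax S (topCell S) := by
  rw [topCell, dif_pos h]; exact Classical.choose_spec (exists_isLexmax h)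

/-- Any top hexagon equals `topCell S`. [cite: MadrasSlade1993, §3.2 (proof of Theorem 3.2.3)] -/
theorem IsLexmax.eq_topCell {S : Finset Cell} {t : Cell} (h : IsLexmax S t) : t = topCell S :=
  h.unique (isLexmax_topCell ⟨t, h.1⟩)

/-- **Trichotomy at the top**: the contacts of the top hexagon lie in `{L t, LL t, LR t}`; hence either `L t ∈ S` (class X), or `L t ∉ S` and
`LR t ∈ S` (class Y⋆), or `nbrs t ∩ S ⊆ {LL t}` (an up-right spike or an isolated hexagon).
[cite: MadrasSlade1993, §3.2 (proof of Theorem 3.2.3: the cases at the lexicographically largest point)] -/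
theorem top_trichotomy {S : Finset Cell} {t : Cell} (h : IsLexmax S t) :
    L t ∈ S ∨ (L t ∉ S ∧ LR t ∈ S) ∨ (L t ∉ S ∧ LR t ∉ S ∧ nbrs t ∩ S ⊆ {LL t}) := by
  by_cases hL : L t ∈ S
  · exact Or.inl hL
  by_cases hLR : LR t ∈ S
  · exact Or.inr (Or.inl ⟨hL, hLR⟩)
  refine Or.inr (Or.inr ⟨hL, hLR, fun c hc => ?_⟩)
  obtain ⟨hc, hcS⟩ := mem_inter.1 hc
  obtain ⟨a, b⟩ := t
  simp only [mem_nbrs_iff] at hc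
  simp only [mem_singleton]
  rcases hc with rfl | rfl | rfl | rfl | rfl | rfl
  · ext <;> simp [LL]
  · exact absurd hcS (by simpa [LR] using hLR)
  · exact absurd hcS (h.notMem_of_right (by simp) (by simp))
  · exact absurd hcS (h.notMem_of_row_lt (by simp))
  · exact absurd hcS (h.notMem_of_row_lt (by simp))
  · exact absurd hcS (by simpa [L] using hL)

open Classical in
/-- **The map `E`** on cell sets: flip if the top hexagon's left neighbour is present, roof otherwise.
[cite: MadrasSlade1993, §3.2, Theorem 3.2.3 (3.2.3) (the surgery at the largest point, transplanted to `ℍ`)] -/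
noncomputable def eImage (S : Finset Cell) : Finset Cell :=
  if L (topCell S) ∈ S then flipImage S (topCell S) else roofImage S (topCell S)

/-- ★ `E` is a `+2` map on every nonempty set whose top hexagon is not an up-right spike (`L t ∈ S` or `LR t ∈ S`).
[cite: MadrasSlade1993, §3.2, Theorem 3.2.3 (3.2.3) and its proof, transplanted to `ℍ`] -/
theorem perim_eImage {S : Finset Cell} {t : Cell} (h : IsLexmax S t) (ht : L t ∈ S ∨ LR t ∈ S) :
    perim (eImage S) = perim S + 2 := by
  classical
  have e := h.eq_topCell
  rw [eImage, ← e]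
  by_cases hL : L t ∈ S
  · rw [if_pos hL]; exact perim_flipImage h hL
  · rw [if_neg hL]
    rcases ht with hL' | hLR
    · exact absurd hL' hL
    · exact perim_roofImage h hLR

/-- `S ⊆ E S`. [cite: MadrasSlade1993, §3.2 (proof of Theorem 3.2.3)] -/
theorem subset_eImage (S : Finset Cell) : S ⊆ eImage S := by
  classical
  rw [eImage]
  split_ifs
  · exact subset_flipImage _ _
  · exact subset_roofImage _ _

/-- The size of `E S`: one more hexagon for the flip, `runLen` more for the roof. [cite: MadrasSlade1993, §3.2 (proof of Theorem 3.2.3)] -/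
theorem card_eImage {S : Finset Cell} {t : Cell} (h : IsLexmax S t) :
    #(eImage S) = #S + (if L t ∈ S then 1 else runLen S t) := by
  classical
  have e := h.eq_topCell
  rw [eImage, ← e]
  by_cases hL : L t ∈ S
  · rw [if_pos hL, if_pos hL]; exact card_flipImage h
  · rw [if_neg hL, if_neg hL]; exact card_roofImage h

end HexCell

end Literature.Probability.RandomPlanarGeometry.SAW
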